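/-
Origin: written from primary sources — S. Gelbart, J. Rogawski, Invent. Math. 105 (1991) §3.1 Remark p. 457 L4–13 (two
splittings differ by a character `ν′` with values in the central `ℂ*`: `s* = s ⊗ ν′`); S. Kudla, *Seesaw dual reductive pairs*
(1984) §1; A. Weil, Acta Math. 111 (1964) Chap. III n° 41 Thm 6. Adapted: no. This file carries the see-saw identities of
`UnitaryDualPairSeesawThetaProduct` / `…SeesawThetaPeriod` over to a big pair splitting NORMALISED by a scalar character
`η` (`Weil1964.AdelicMetaplecticScalarTwist`), under the hypothesis that `η` splits along the see-saw torus. Kernel only;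
no records.
-/
import Literature.NumberTheory.GelbartRogawski1991.UnitaryDualPairSeesawThetaPeriod
import HarnessLib

/-!
# (eq:seesaw) at the data of record for a NORMALISED big splitting `s_pair ⊗ η`

The W-block of record of the Hodge-CM construction (`wmInputCM₂b`, tree `UnitaryDualPairThetaKernelCMTwist.cmPairRepTwist`)
carries the Weil representation of the big pair in a splitting normalised by a character `η` of
`U(J_V)(𝔸) × U(J_W)(𝔸)` (`ω_ψ ∘ (s_pair ⊗ η) = η • (ω_ψ ∘ s_pair)`, `adelicMpCont.omega_twist`); `η` need NOT factor through
the group `U(J_V ⊗ J_W)(𝔸)` (its value on the anti-diagonal centre is Kudla's `β`).  This file reads the see-saw identities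
of `UnitaryDualPairSeesawThetaProduct` §2 / `UnitaryDualPairSeesawThetaPeriod` §3 (conjugated torus
`(u₁,u₂) ↦ g (u₁ ⊕ᶠ u₂) g⁻¹`, the form the pins use for BOTH tori with `g = 1` or `g = g₀`) through such a twist:

* §1 `thetaDistLM_twist_pairRep_isometryConj_seesawConjTensor`:
  `Θ(ω_ψ((s_pair ⊗ η)(v, w♯)) (Φ₁ ⊗' Φ₂)) = η(v, w♯) · Θ(ω₁″(v,u₁) Φ₁) · Θ(ω₂″(v,u₂) Φ₂)`, `w♯ = g (u₁ ⊕ᶠ u₂) g⁻¹`;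
* §2 under the SPLITTING HYPOTHESIS `hsplit : η(v, w♯) = η_a(v,u₁) · η_b(v,u₂)` (two characters of the small pairs; for
  `η = χ_V∘det ⊠ χ_W∘det` one may take `η_a(v,u₁) = χ_V(det v) χ_W(det u₁)`, `η_b(v,u₂) = χ_W(det u₂)`): the twisted small
  representations `ω_j‴ := η_• • ω_j″` (`seesawConjRepTwist₁/₂`), their `Θ`-invariance at rational points (for `η_a, η_b`
  trivial there, hypotheses `hηa`, `hηb`), their majorants from `hM₃`/`hM₄` and continuity of `η_a, η_b`
  (`hasThetaMajorants_seesawConjRepTwist₁/₂`), their theta-KERNEL DATA `seesawConjDatumTwist₁/₂`, and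
  **`isSeesawProduct_twist_seesawConjTensor`** / **`seesawConjPeriodTwist_eq_thetaLift_mul`**: for the big datum
  `adelicOfDualPairRep (ω_ψ ∘ (s_pair ⊗ η)) …` (ANY majorant/stabiliser witnesses — the pin's own
  `hasThetaMajorants_cmPairRepTwist` / `cmPairRepTwist_toHomUnits_mem_thetaStabilizer`), the period of its theta kernel of
  `Φ₁ ⊗' Φ₂` over the conjugated see-saw torus against `f₁ ⊠ f₂` is the product of the two `ω_j‴`-theta lifts — PerL v5
  (eq:seesaw) (tex ll. 323–326) for the NORMALISED constructed objects; `seesawConjPeriodTwist_wedge_eq_det` is its wedge form.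

Provenance / use: Hodge-CM rows `gen12`/`real34`, PKG consumer `Gen12FunBridge.wf_gen`; dictionary (unitary-1-g4, STATUS
2026-08-19T09:49:53Z): `F := L⁺`, `E := L`, `c := complexConj`, `(N, M₁, M₂) := (3, 1, 1)`, `eW := finProdFinEquiv`,
`s := splittingOf hGR` (so `pairSplitting … s = cmPairSplitting hGR`), `η := η_det`, `g := 1` / `g₀`.  Nothing here is a
claim of the manuscripts under adjudication.
-/

set_option autoImplicit false

noncomputable section

open scoped Matrix Kronecker
open _root_.MeasureTheory NumberField
open Literature.RepresentationTheory Literature.RepresentationTheory.SeesawScalar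
open Literature.RepresentationTheory.HeisenbergGroup
open Literature.NumberTheory.Automorphic
open Literature.NumberTheory.Automorphic.UnitaryGroup
open Literature.NumberTheory.Weil1964
open Literature.NumberTheory.Weil1964.ThetaKernelDatum

namespace Literature.NumberTheory.GelbartRogawski1991

namespace UnitaryDualPair

section TwistThirtyFour


variable (F E : Type) [Field F] [NumberField F] [Field E] [NumberField E] [Algebra F E]
variable (c : E ≃ₐ[F] E) (N M₁ M₂ : ℕ) {n n₁ n₂ : ℕ} (eW : Fin N × Fin (M₁ + M₂) ≃ Fin n)
  (e₁ : Fin N × Fin M₁ ≃ Fin n₁) (e₂ : Fin N × Fin M₂ ≃ Fin n₂)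
variable (JV : Matrix (Fin N) (Fin N) E) (JW : Matrix (Fin (M₁ + M₂)) (Fin (M₁ + M₂)) E)
  (J₁ : Matrix (Fin M₁) (Fin M₁) E) (J₂ : Matrix (Fin M₂) (Fin M₂) E)
variable {TV : Matrix (Fin N) (Fin N) F} {TW : Matrix (Fin (M₁ + M₂)) (Fin (M₁ + M₂)) F}
  {T₁ : Matrix (Fin M₁) (Fin M₁) F} {T₂ : Matrix (Fin M₂) (Fin M₂) F}
variable [Algebra.IsQuadraticExtension F E] {δ : E} (hcδ : c δ = -δ) (hδ : δ ≠ 0) {d : F}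
  (hd : δ * δ = algebraMap F E d) (hV : TV.IsSymm) (hW : TW.IsSymm) (h₁ : T₁.IsSymm) (h₂ : T₂.IsSymm)
  (hVd : IsUnit TV.det) (hTWd : IsUnit TW.det) (h₁d : IsUnit T₁.det) (h₂d : IsUnit T₂.det)
  (hT : IsUnit (TV.map (algebraMap F (AdeleRing (𝓞 F) F)) ⊗ₖ TW.map (algebraMap F (AdeleRing (𝓞 F) F))).det)
  (hJV : JV = TV.map (algebraMap F E)) (hJW : JW = TW.map (algebraMap F E))
  (hJ₁ : J₁ = T₁.map (algebraMap F E)) (hJ₂ : J₂ = T₂.map (algebraMap F E))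
  {s : adelicPair F E c N (M₁ + M₂) JV JW →* adelicMpCont F (Fin n) (adelicGram F eW TV TW)}
  {s₁ : adelicPair F E c N M₁ JV J₁ →* adelicMpCont F (Fin n₁) (adelicGram F e₁ TV T₁)}
  {s₂ : adelicPair F E c N M₂ JV J₂ →* adelicMpCont F (Fin n₂) (adelicGram F e₂ TV T₂)}
  {g : GL (Fin (M₁ + M₂)) (AdeleRing (𝓞 E) E)} {g₀ : GL (Fin (M₁ + M₂)) E}
  (hgg₀ : (g : Matrix (Fin (M₁ + M₂)) (Fin (M₁ + M₂)) (AdeleRing (𝓞 E) E)) =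
    ((g₀ : GL (Fin (M₁ + M₂)) E) : Matrix (Fin (M₁ + M₂)) (Fin (M₁ + M₂)) E).map (algebraMap E (AdeleRing (𝓞 E) E)))
  (hg : ((g : Matrix (Fin (M₁ + M₂)) (Fin (M₁ + M₂)) (AdeleRing (𝓞 E) E)).map (conjAdele F E c))ᵀ *
      adelicForm E (M₁ + M₂) JW * g = adelicForm E (M₁ + M₂) (finSum M₁ M₂ J₁ J₂))
  {C : GL (Fin N × Fin (M₁ + M₂)) (AdeleRing (𝓞 F) F)} {C₀ : GL (Fin N × Fin (M₁ + M₂)) F}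
  (hCC₀ : (C : Matrix (Fin N × Fin (M₁ + M₂)) (Fin N × Fin (M₁ + M₂)) (AdeleRing (𝓞 F) F)) =
    ((C₀ : GL (Fin N × Fin (M₁ + M₂)) F) : Matrix (Fin N × Fin (M₁ + M₂)) (Fin N × Fin (M₁ + M₂)) F).map
      (algebraMap F (AdeleRing (𝓞 F) F)))
  (hC : TV.map (algebraMap F (AdeleRing (𝓞 F) F)) ⊗ₖ TW.map (algebraMap F (AdeleRing (𝓞 F) F)) *
      (C : Matrix (Fin N × Fin (M₁ + M₂)) (Fin N × Fin (M₁ + M₂)) (AdeleRing (𝓞 F) F)) =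
    TV.map (algebraMap F (AdeleRing (𝓞 F) F)) ⊗ₖ (finSum M₁ M₂ T₁ T₂).map (algebraMap F (AdeleRing (𝓞 F) F)))
  (hs : (splittingDatum F E c N (M₁ + M₂) eW JV JW hcδ hδ hd hV hW hVd hTWd hJV hJW).IsCompatible s)
  (hs₁ : (splittingDatum F E c N M₁ e₁ JV J₁ hcδ hδ hd hV h₁ hVd h₁d hJV hJ₁).IsCompatible s₁)
  (hs₂ : (splittingDatum F E c N M₂ e₂ JV J₂ hcδ hδ hd hV h₂ hVd h₂d hJV hJ₂).IsCompatible s₂)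
  (hg₀ : (((g₀ : GL (Fin (M₁ + M₂)) E) : Matrix (Fin (M₁ + M₂)) (Fin (M₁ + M₂)) E).map (c : E →+* E))ᵀ * JW * g₀ =
    finSum M₁ M₂ J₁ J₂)
variable (η : adelic F E c N JV × adelic F E c (M₁ + M₂) JW →* ℂˣ)
  (ηa : adelic F E c N JV × adelic F E c M₁ J₁ →* ℂˣ) (ηb : adelic F E c N JV × adelic F E c M₂ J₂ →* ℂˣ)

/-! ### §1 The kernel identity through the twist -/

/-- **see-saw of theta kernels for the NORMALISED big splitting**:
`Θ(ω_ψ((s_pair ⊗ η)(v, g (u₁ ⊕ᶠ u₂) g⁻¹)) (Φ₁ ⊗' Φ₂)) = η(v, g (u₁ ⊕ᶠ u₂) g⁻¹) · (Θ(ω₁″(v,u₁) Φ₁) · Θ(ω₂″(v,u₂) Φ₂))`.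
[cite: GelbartRogawski1991, §3.1 Remark p. 457] -/
theorem thetaDistLM_twist_pairRep_isometryConj_seesawConjTensor (v : adelic F E c N JV) (u₁ : adelic F E c M₁ J₁)
    (u₂ : adelic F E c M₂ J₂) (Φ₁ : piSchwartzBruhat F (Fin N × Fin M₁)) (Φ₂ : piSchwartzBruhat F (Fin N × Fin M₂)) :
    thetaDistLM F (Fin n)
        ((adelicMpCont.omega F (Fin n) (adelicGram F eW TV TW))
          ((adelicMpCont.twist F (Fin n) (adelicGram F eW TV TW) (pairSplitting F E c N (M₁ + M₂) eW JV JW s) η) (v, adelicIsometryConj F E c (M₁ + M₂) g hg (adelicBlockDiag F E c M₁ M₂ J₁ J₂ (u₁, u₂))))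
          (seesawConjTensor F E c N M₁ M₂ eW JV JW J₁ J₂ hcδ hδ hd hV hW h₁ h₂ hVd hTWd hT hJV hJW hJ₁ hJ₂ hgg₀ hg hCC₀ hC Φ₁ Φ₂)) =
      ((η (v, adelicIsometryConj F E c (M₁ + M₂) g hg (adelicBlockDiag F E c M₁ M₂ J₁ J₂ (u₁, u₂))) : ℂˣ) : ℂ) *
        (thetaDistLM F (Fin N × Fin M₁) (seesawConjRep₁ F E c N M₁ M₂ eW e₁ e₂ JV JW J₁ J₂ hcδ hδ hd hV hW h₁ h₂ hVd hTWd h₁d h₂d hT hJV hJW hJ₁ hJ₂ hgg₀ hg hCC₀ hC hs hs₁ hs₂ (v, u₁) Φ₁) *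
          thetaDistLM F (Fin N × Fin M₂) (seesawConjRep₂ F E c N M₁ M₂ eW e₁ e₂ JV JW J₁ J₂ hcδ hδ hd hV hW h₁ h₂ hVd hTWd h₁d h₂d hT hJV hJW hJ₁ hJ₂ hgg₀ hg hCC₀ hC hs hs₁ hs₂ (v, u₂) Φ₂)) :=
  ((LinearMap.map_smul (thetaDistLM F (Fin n)) _ _).trans
    (congrArg (fun t : ℂ =>
        ((η (v, adelicIsometryConj F E c (M₁ + M₂) g hg (adelicBlockDiag F E c M₁ M₂ J₁ J₂ (u₁, u₂))) : ℂˣ) : ℂ) * t)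
      (thetaDistLM_pairRep_isometryConj_seesawConjTensor F E c N M₁ M₂ eW e₁ e₂ JV JW J₁ J₂ hcδ hδ hd hV hW h₁ h₂ hVd hTWd h₁d h₂d hT hJV hJW hJ₁ hJ₂ hgg₀ hg hCC₀ hC hs hs₁ hs₂ v u₁ u₂ Φ₁ Φ₂)))

/-! ### §2 Splitting `η` along the see-saw torus: twisted small data and (eq:seesaw) -/

variable (hsplit : ∀ (v : adelic F E c N JV) (u₁ : adelic F E c M₁ J₁) (u₂ : adelic F E c M₂ J₂),
    η (v, adelicIsometryConj F E c (M₁ + M₂) g hg (adelicBlockDiag F E c M₁ M₂ J₁ J₂ (u₁, u₂))) = ηa (v, u₁) * ηb (v, u₂))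

/-- **`ω₁‴ := η_a • ω₁″`** — the first small representation twisted by its share of `η`. [folklore] -/
def seesawConjRepTwist₁ : Representation ℂ (adelic F E c N JV × adelic F E c M₁ J₁) (piSchwartzBruhat F (Fin N × Fin M₁)) :=
  SeesawScalar.twist ηa (seesawConjRep₁ F E c N M₁ M₂ eW e₁ e₂ JV JW J₁ J₂ hcδ hδ hd hV hW h₁ h₂ hVd hTWd h₁d h₂d hT hJV hJW hJ₁ hJ₂ hgg₀ hg hCC₀ hC hs hs₁ hs₂)

/-- **`ω₂‴ := η_b • ω₂″`**. [folklore] -/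
def seesawConjRepTwist₂ : Representation ℂ (adelic F E c N JV × adelic F E c M₂ J₂) (piSchwartzBruhat F (Fin N × Fin M₂)) :=
  SeesawScalar.twist ηb (seesawConjRep₂ F E c N M₁ M₂ eW e₁ e₂ JV JW J₁ J₂ hcδ hδ hd hV hW h₁ h₂ hVd hTWd h₁d h₂d hT hJV hJW hJ₁ hJ₂ hgg₀ hg hCC₀ hC hs hs₁ hs₂)

/-- unfolding: `ω₁‴ p Φ = η_a p • ω₁″ p Φ`. [folklore] -/
theorem seesawConjRepTwist₁_apply (p : adelic F E c N JV × adelic F E c M₁ J₁) (Φ : piSchwartzBruhat F (Fin N × Fin M₁)) :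
    seesawConjRepTwist₁ F E c N M₁ M₂ eW e₁ e₂ JV JW J₁ J₂ hcδ hδ hd hV hW h₁ h₂ hVd hTWd h₁d h₂d hT hJV hJW hJ₁ hJ₂ hgg₀ hg hCC₀ hC hs hs₁ hs₂ ηa p Φ = ((ηa p : ℂˣ) : ℂ) • seesawConjRep₁ F E c N M₁ M₂ eW e₁ e₂ JV JW J₁ J₂ hcδ hδ hd hV hW h₁ h₂ hVd hTWd h₁d h₂d hT hJV hJW hJ₁ hJ₂ hgg₀ hg hCC₀ hC hs hs₁ hs₂ p Φ :=
  rfl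

/-- unfolding: `ω₂‴ p Φ = η_b p • ω₂″ p Φ`. [folklore] -/
theorem seesawConjRepTwist₂_apply (p : adelic F E c N JV × adelic F E c M₂ J₂) (Φ : piSchwartzBruhat F (Fin N × Fin M₂)) :
    seesawConjRepTwist₂ F E c N M₁ M₂ eW e₁ e₂ JV JW J₁ J₂ hcδ hδ hd hV hW h₁ h₂ hVd hTWd h₁d h₂d hT hJV hJW hJ₁ hJ₂ hgg₀ hg hCC₀ hC hs hs₁ hs₂ ηb p Φ = ((ηb p : ℂˣ) : ℂ) • seesawConjRep₂ F E c N M₁ M₂ eW e₁ e₂ JV JW J₁ J₂ hcδ hδ hd hV hW h₁ h₂ hVd hTWd h₁d h₂d hT hJV hJW hJ₁ hJ₂ hgg₀ hg hCC₀ hC hs hs₁ hs₂ p Φ :=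
  rfl

include hsplit in
/-- **see-saw of theta kernels for the normalised splitting, η split**:
`Θ(ω_ψ((s_pair ⊗ η)(v, w♯)) (Φ₁ ⊗' Φ₂)) = Θ(ω₁‴(v,u₁) Φ₁) · Θ(ω₂‴(v,u₂) Φ₂)`. [cite: Kudla1984, §1] -/
theorem thetaDistLM_twist_pairRep_isometryConj_seesawConjTensor_split (v : adelic F E c N JV) (u₁ : adelic F E c M₁ J₁)
    (u₂ : adelic F E c M₂ J₂) (Φ₁ : piSchwartzBruhat F (Fin N × Fin M₁)) (Φ₂ : piSchwartzBruhat F (Fin N × Fin M₂)) :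
    thetaDistLM F (Fin n)
        ((adelicMpCont.omega F (Fin n) (adelicGram F eW TV TW))
          ((adelicMpCont.twist F (Fin n) (adelicGram F eW TV TW) (pairSplitting F E c N (M₁ + M₂) eW JV JW s) η) (v, adelicIsometryConj F E c (M₁ + M₂) g hg (adelicBlockDiag F E c M₁ M₂ J₁ J₂ (u₁, u₂))))
          (seesawConjTensor F E c N M₁ M₂ eW JV JW J₁ J₂ hcδ hδ hd hV hW h₁ h₂ hVd hTWd hT hJV hJW hJ₁ hJ₂ hgg₀ hg hCC₀ hC Φ₁ Φ₂)) =
      thetaDistLM F (Fin N × Fin M₁) (seesawConjRepTwist₁ F E c N M₁ M₂ eW e₁ e₂ JV JW J₁ J₂ hcδ hδ hd hV hW h₁ h₂ hVd hTWd h₁d h₂d hT hJV hJW hJ₁ hJ₂ hgg₀ hg hCC₀ hC hs hs₁ hs₂ ηa (v, u₁) Φ₁) *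
        thetaDistLM F (Fin N × Fin M₂) (seesawConjRepTwist₂ F E c N M₁ M₂ eW e₁ e₂ JV JW J₁ J₂ hcδ hδ hd hV hW h₁ h₂ hVd hTWd h₁d h₂d hT hJV hJW hJ₁ hJ₂ hgg₀ hg hCC₀ hC hs hs₁ hs₂ ηb (v, u₂) Φ₂) := by
  rw [thetaDistLM_twist_pairRep_isometryConj_seesawConjTensor F E c N M₁ M₂ eW e₁ e₂ JV JW J₁ J₂ hcδ hδ hd hV hW h₁ h₂ hVd hTWd h₁d h₂d hT hJV hJW hJ₁ hJ₂ hgg₀ hg hCC₀ hC hs hs₁ hs₂ η v u₁ u₂ Φ₁ Φ₂, hsplit v u₁ u₂,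
    seesawConjRepTwist₁_apply, seesawConjRepTwist₂_apply, LinearMap.map_smul, LinearMap.map_smul, smul_eq_mul,
    smul_eq_mul, Units.val_mul]
  ring

variable (hηa : ∀ γU ∈ (toAdelic F E c N JV).range, ∀ γ ∈ (toAdelic F E c M₁ J₁).range, ηa (γU, γ) = 1)
  (hηb : ∀ γU ∈ (toAdelic F E c N JV).range, ∀ γ ∈ (toAdelic F E c M₂ J₂).range, ηb (γU, γ) = 1)

include hg₀ hηa in
/-- `ω₁‴(γ_U, γ)` fixes `Θ` at rational points (`η_a` trivial there). [cite: Weil1964, Chap. III n° 41 Thm 6 p. 193] -/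
theorem seesawConjRepTwist₁_toHomUnits_mem_thetaStabilizer {γU : adelic F E c N JV}
    (hγU : γU ∈ (toAdelic F E c N JV).range) {γ : adelic F E c M₁ J₁} (hγ : γ ∈ (toAdelic F E c M₁ J₁).range) :
    (seesawConjRepTwist₁ F E c N M₁ M₂ eW e₁ e₂ JV JW J₁ J₂ hcδ hδ hd hV hW h₁ h₂ hVd hTWd h₁d h₂d hT hJV hJW hJ₁ hJ₂ hgg₀ hg hCC₀ hC hs hs₁ hs₂ ηa).toHomUnits (γU, γ) ∈ thetaStabilizer F (Fin N × Fin M₁) :=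
  (toHomUnits_mem_thetaStabilizer_iff _ _).2 fun Φ =>
    (congrArg (thetaDistLM F (Fin N × Fin M₁))
        (LinearMap.congr_fun (SeesawScalar.twist_apply_of_eq_one _ (hηa γU hγU γ hγ)) Φ)).trans
      ((toHomUnits_mem_thetaStabilizer_iff _ _).1
        (seesawConjRep₁_toHomUnits_mem_thetaStabilizer F E c N M₁ M₂ eW e₁ e₂ JV JW J₁ J₂ hcδ hδ hd hV hW h₁ h₂ hVd hTWd h₁d h₂d hT hJV hJW hJ₁ hJ₂ hgg₀ hg hCC₀ hC hs hs₁ hs₂ hg₀ hγU hγ) Φ)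

include hg₀ hηb in
/-- `ω₂‴(γ_U, γ)` fixes `Θ` at rational points. [cite: Weil1964, Chap. III n° 41 Thm 6 p. 193] -/
theorem seesawConjRepTwist₂_toHomUnits_mem_thetaStabilizer {γU : adelic F E c N JV}
    (hγU : γU ∈ (toAdelic F E c N JV).range) {γ : adelic F E c M₂ J₂} (hγ : γ ∈ (toAdelic F E c M₂ J₂).range) :
    (seesawConjRepTwist₂ F E c N M₁ M₂ eW e₁ e₂ JV JW J₁ J₂ hcδ hδ hd hV hW h₁ h₂ hVd hTWd h₁d h₂d hT hJV hJW hJ₁ hJ₂ hgg₀ hg hCC₀ hC hs hs₁ hs₂ ηb).toHomUnits (γU, γ) ∈ thetaStabilizer F (Fin N × Fin M₂) :=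
  (toHomUnits_mem_thetaStabilizer_iff _ _).2 fun Φ =>
    (congrArg (thetaDistLM F (Fin N × Fin M₂))
        (LinearMap.congr_fun (SeesawScalar.twist_apply_of_eq_one _ (hηb γU hγU γ hγ)) Φ)).trans
      ((toHomUnits_mem_thetaStabilizer_iff _ _).1
        (seesawConjRep₂_toHomUnits_mem_thetaStabilizer F E c N M₁ M₂ eW e₁ e₂ JV JW J₁ J₂ hcδ hδ hd hV hW h₁ h₂ hVd hTWd h₁d h₂d hT hJV hJW hJ₁ hJ₂ hgg₀ hg hCC₀ hC hs hs₁ hs₂ hg₀ hγU hγ) Φ)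

/-- majorants of `ω₁‴` from majorants of `ω₁″` (`hM₃`) and continuity of `η_a`. [cite: Weil1964, Chap. III n° 41 Lemme 5 p. 194] -/
theorem hasThetaMajorants_seesawConjRepTwist₁
    (hM₃ : HasThetaMajorants fun (p : adelic F E c N JV × adelic F E c M₁ J₁) (Φ : piSchwartzBruhat F (Fin N × Fin M₁)) =>
      seesawConjRep₁ F E c N M₁ M₂ eW e₁ e₂ JV JW J₁ J₂ hcδ hδ hd hV hW h₁ h₂ hVd hTWd h₁d h₂d hT hJV hJW hJ₁ hJ₂ hgg₀ hg hCC₀ hC hs hs₁ hs₂ p Φ)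
    (hηac : Continuous fun p => ((ηa p : ℂˣ) : ℂ)) :
    HasThetaMajorants fun (p : adelic F E c N JV × adelic F E c M₁ J₁) (Φ : piSchwartzBruhat F (Fin N × Fin M₁)) =>
      seesawConjRepTwist₁ F E c N M₁ M₂ eW e₁ e₂ JV JW J₁ J₂ hcδ hδ hd hV hW h₁ h₂ hVd hTWd h₁d h₂d hT hJV hJW hJ₁ hJ₂ hgg₀ hg hCC₀ hC hs hs₁ hs₂ ηa p Φ :=
  hM₃.smul hηac

/-- majorants of `ω₂‴` from `hM₄` and continuity of `η_b`. [cite: Weil1964, Chap. III n° 41 Lemme 5 p. 194] -/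
theorem hasThetaMajorants_seesawConjRepTwist₂
    (hM₄ : HasThetaMajorants fun (p : adelic F E c N JV × adelic F E c M₂ J₂) (Φ : piSchwartzBruhat F (Fin N × Fin M₂)) =>
      seesawConjRep₂ F E c N M₁ M₂ eW e₁ e₂ JV JW J₁ J₂ hcδ hδ hd hV hW h₁ h₂ hVd hTWd h₁d h₂d hT hJV hJW hJ₁ hJ₂ hgg₀ hg hCC₀ hC hs hs₁ hs₂ p Φ)
    (hηbc : Continuous fun p => ((ηb p : ℂˣ) : ℂ)) :
    HasThetaMajorants fun (p : adelic F E c N JV × adelic F E c M₂ J₂) (Φ : piSchwartzBruhat F (Fin N × Fin M₂)) =>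
      seesawConjRepTwist₂ F E c N M₁ M₂ eW e₁ e₂ JV JW J₁ J₂ hcδ hδ hd hV hW h₁ h₂ hVd hTWd h₁d h₂d hT hJV hJW hJ₁ hJ₂ hgg₀ hg hCC₀ hC hs hs₁ hs₂ ηb p Φ :=
  hM₄.smul hηbc

variable [LocallyCompactSpace (adelic F E c N JV)] [LocallyCompactSpace (adelic F E c M₁ J₁)]
  [LocallyCompactSpace (adelic F E c M₂ J₂)] [LocallyCompactSpace (adelic F E c (M₁ + M₂) JW)]

include hg₀ hηa in
/-- **the theta-kernel datum of `ω₁‴`** (hypotheses `hM₃'` = majorants of `ω₁‴`, e.g. from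
`hasThetaMajorants_seesawConjRepTwist₁`; `SK₁`/`hSK₁` an `U(J₁)(𝔸)`-stable index set). [cite: Weil1964, Chap. III n° 41 Thm 6 p. 193] -/
def seesawConjDatumTwist₁
    (hM₃' : HasThetaMajorants fun (p : adelic F E c N JV × adelic F E c M₁ J₁) (Φ : piSchwartzBruhat F (Fin N × Fin M₁)) =>
      seesawConjRepTwist₁ F E c N M₁ M₂ eW e₁ e₂ JV JW J₁ J₂ hcδ hδ hd hV hW h₁ h₂ hVd hTWd h₁d h₂d hT hJV hJW hJ₁ hJ₂ hgg₀ hg hCC₀ hC hs hs₁ hs₂ ηa p Φ)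
    (SK₁ : Set (piSchwartzBruhat F (Fin N × Fin M₁)))
    (hSK₁ : ∀ (h : adelic F E c M₁ J₁) (Φ : piSchwartzBruhat F (Fin N × Fin M₁)), Φ ∈ SK₁ →
      seesawConjRepTwist₁ F E c N M₁ M₂ eW e₁ e₂ JV JW J₁ J₂ hcδ hδ hd hV hW h₁ h₂ hVd hTWd h₁d h₂d hT hJV hJW hJ₁ hJ₂ hgg₀ hg hCC₀ hC hs hs₁ hs₂ ηa (1, h) Φ ∈ SK₁) :
    ThetaKernelDatum (adelic F E c N JV × adelic F E c M₁ J₁)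
      (repWeilThetaDatum F (Fin N × Fin M₁) (seesawConjRepTwist₁ F E c N M₁ M₂ eW e₁ e₂ JV JW J₁ J₂ hcδ hδ hd hV hW h₁ h₂ hVd hTWd h₁d h₂d hT hJV hJW hJ₁ hJ₂ hgg₀ hg hCC₀ hC hs hs₁ hs₂ ηa).toHomUnits
        ((((toAdelic F E c N JV).range).prod (toAdelic F E c M₁ J₁).range :
            Subgroup (adelic F E c N JV × adelic F E c M₁ J₁)) :
          Set (adelic F E c N JV × adelic F E c M₁ J₁))).ThetaTop
      (adelic F E c N JV) (toAdelic F E c N JV).range (adelic F E c M₁ J₁) (toAdelic F E c M₁ J₁).range :=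
  ThetaKernelDatum.adelicOfDualPairRep (ΓU := (toAdelic F E c N JV).range) (Γ := (toAdelic F E c M₁ J₁).range)
    (seesawConjRepTwist₁ F E c N M₁ M₂ eW e₁ e₂ JV JW J₁ J₂ hcδ hδ hd hV hW h₁ h₂ hVd hTWd h₁d h₂d hT hJV hJW hJ₁ hJ₂ hgg₀ hg hCC₀ hC hs hs₁ hs₂ ηa) hM₃'
    (fun _ hγU _ hγ => seesawConjRepTwist₁_toHomUnits_mem_thetaStabilizer F E c N M₁ M₂ eW e₁ e₂ JV JW J₁ J₂ hcδ hδ hd hV hW h₁ h₂ hVd hTWd h₁d h₂d hT hJV hJW hJ₁ hJ₂ hgg₀ hg hCC₀ hC hs hs₁ hs₂ hg₀ ηa hηa hγU hγ) SK₁ hSK₁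

include hg₀ hηb in
/-- **the theta-kernel datum of `ω₂‴`**. [cite: Weil1964, Chap. III n° 41 Thm 6 p. 193] -/
def seesawConjDatumTwist₂
    (hM₄' : HasThetaMajorants fun (p : adelic F E c N JV × adelic F E c M₂ J₂) (Φ : piSchwartzBruhat F (Fin N × Fin M₂)) =>
      seesawConjRepTwist₂ F E c N M₁ M₂ eW e₁ e₂ JV JW J₁ J₂ hcδ hδ hd hV hW h₁ h₂ hVd hTWd h₁d h₂d hT hJV hJW hJ₁ hJ₂ hgg₀ hg hCC₀ hC hs hs₁ hs₂ ηb p Φ)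
    (SK₂ : Set (piSchwartzBruhat F (Fin N × Fin M₂)))
    (hSK₂ : ∀ (h : adelic F E c M₂ J₂) (Φ : piSchwartzBruhat F (Fin N × Fin M₂)), Φ ∈ SK₂ →
      seesawConjRepTwist₂ F E c N M₁ M₂ eW e₁ e₂ JV JW J₁ J₂ hcδ hδ hd hV hW h₁ h₂ hVd hTWd h₁d h₂d hT hJV hJW hJ₁ hJ₂ hgg₀ hg hCC₀ hC hs hs₁ hs₂ ηb (1, h) Φ ∈ SK₂) :
    ThetaKernelDatum (adelic F E c N JV × adelic F E c M₂ J₂)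
      (repWeilThetaDatum F (Fin N × Fin M₂) (seesawConjRepTwist₂ F E c N M₁ M₂ eW e₁ e₂ JV JW J₁ J₂ hcδ hδ hd hV hW h₁ h₂ hVd hTWd h₁d h₂d hT hJV hJW hJ₁ hJ₂ hgg₀ hg hCC₀ hC hs hs₁ hs₂ ηb).toHomUnits
        ((((toAdelic F E c N JV).range).prod (toAdelic F E c M₂ J₂).range :
            Subgroup (adelic F E c N JV × adelic F E c M₂ J₂)) :
          Set (adelic F E c N JV × adelic F E c M₂ J₂))).ThetaTop
      (adelic F E c N JV) (toAdelic F E c N JV).range (adelic F E c M₂ J₂) (toAdelic F E c M₂ J₂).range :=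
  ThetaKernelDatum.adelicOfDualPairRep (ΓU := (toAdelic F E c N JV).range) (Γ := (toAdelic F E c M₂ J₂).range)
    (seesawConjRepTwist₂ F E c N M₁ M₂ eW e₁ e₂ JV JW J₁ J₂ hcδ hδ hd hV hW h₁ h₂ hVd hTWd h₁d h₂d hT hJV hJW hJ₁ hJ₂ hgg₀ hg hCC₀ hC hs hs₁ hs₂ ηb) hM₄'
    (fun _ hγU _ hγ => seesawConjRepTwist₂_toHomUnits_mem_thetaStabilizer F E c N M₁ M₂ eW e₁ e₂ JV JW J₁ J₂ hcδ hδ hd hV hW h₁ h₂ hVd hTWd h₁d h₂d hT hJV hJW hJ₁ hJ₂ hgg₀ hg hCC₀ hC hs hs₁ hs₂ hg₀ ηb hηb hγU hγ) SK₂ hSK₂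

variable
  (hρ' : HasThetaMajorants fun (p : adelic F E c N JV × adelic F E c (M₁ + M₂) JW) (Φ : piSchwartzBruhat F (Fin n)) =>
    ((adelicMpCont.omega F (Fin n) (adelicGram F eW TV TW)).comp (adelicMpCont.twist F (Fin n) (adelicGram F eW TV TW) (pairSplitting F E c N (M₁ + M₂) eW JV JW s) η)) p Φ)
  (hrat' : ∀ γU ∈ (toAdelic F E c N JV).range, ∀ γ ∈ (toAdelic F E c (M₁ + M₂) JW).range,
    ((adelicMpCont.omega F (Fin n) (adelicGram F eW TV TW)).comp (adelicMpCont.twist F (Fin n) (adelicGram F eW TV TW) (pairSplitting F E c N (M₁ + M₂) eW JV JW s) η)).toHomUnits (γU, γ) ∈ thetaStabilizer F (Fin n))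
  (SK : Set (piSchwartzBruhat F (Fin n)))
  (hSK : ∀ (h : adelic F E c (M₁ + M₂) JW) (Φ : piSchwartzBruhat F (Fin n)), Φ ∈ SK →
    ((adelicMpCont.omega F (Fin n) (adelicGram F eW TV TW)).comp (adelicMpCont.twist F (Fin n) (adelicGram F eW TV TW) (pairSplitting F E c N (M₁ + M₂) eW JV JW s) η)) (1, h) Φ ∈ SK)
  (hM₃' : HasThetaMajorants fun (p : adelic F E c N JV × adelic F E c M₁ J₁) (Φ : piSchwartzBruhat F (Fin N × Fin M₁)) =>
    seesawConjRepTwist₁ F E c N M₁ M₂ eW e₁ e₂ JV JW J₁ J₂ hcδ hδ hd hV hW h₁ h₂ hVd hTWd h₁d h₂d hT hJV hJW hJ₁ hJ₂ hgg₀ hg hCC₀ hC hs hs₁ hs₂ ηa p Φ)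
  (SK₁ : Set (piSchwartzBruhat F (Fin N × Fin M₁)))
  (hSK₁ : ∀ (h : adelic F E c M₁ J₁) (Φ : piSchwartzBruhat F (Fin N × Fin M₁)), Φ ∈ SK₁ →
    seesawConjRepTwist₁ F E c N M₁ M₂ eW e₁ e₂ JV JW J₁ J₂ hcδ hδ hd hV hW h₁ h₂ hVd hTWd h₁d h₂d hT hJV hJW hJ₁ hJ₂ hgg₀ hg hCC₀ hC hs hs₁ hs₂ ηa (1, h) Φ ∈ SK₁)
  (hM₄' : HasThetaMajorants fun (p : adelic F E c N JV × adelic F E c M₂ J₂) (Φ : piSchwartzBruhat F (Fin N × Fin M₂)) =>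
    seesawConjRepTwist₂ F E c N M₁ M₂ eW e₁ e₂ JV JW J₁ J₂ hcδ hδ hd hV hW h₁ h₂ hVd hTWd h₁d h₂d hT hJV hJW hJ₁ hJ₂ hgg₀ hg hCC₀ hC hs hs₁ hs₂ ηb p Φ)
  (SK₂ : Set (piSchwartzBruhat F (Fin N × Fin M₂)))
  (hSK₂ : ∀ (h : adelic F E c M₂ J₂) (Φ : piSchwartzBruhat F (Fin N × Fin M₂)), Φ ∈ SK₂ →
    seesawConjRepTwist₂ F E c N M₁ M₂ eW e₁ e₂ JV JW J₁ J₂ hcδ hδ hd hV hW h₁ h₂ hVd hTWd h₁d h₂d hT hJV hJW hJ₁ hJ₂ hgg₀ hg hCC₀ hC hs hs₁ hs₂ ηb (1, h) Φ ∈ SK₂)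

include hsplit in
/-- **`IsSeesawProduct` for the NORMALISED big datum**: Weil's datum of `ω_ψ ∘ (s_pair ⊗ η)` (any majorant / stabiliser
witnesses) and the two `ω_j‴`-data have product kernels along `(u₁,u₂) ↦ g (u₁ ⊕ᶠ u₂) g⁻¹` for `Φ₁ ⊗' Φ₂`.
[cite: Kudla1984, §1] -/
theorem isSeesawProduct_twist_seesawConjTensor (Φ₁ : piSchwartzBruhat F (Fin N × Fin M₁))
    (Φ₂ : piSchwartzBruhat F (Fin N × Fin M₂)) :
    IsSeesawProduct
      (ThetaKernelDatum.adelicOfDualPairRep (ΓU := (toAdelic F E c N JV).range)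
        (Γ := (toAdelic F E c (M₁ + M₂) JW).range) ((adelicMpCont.omega F (Fin n) (adelicGram F eW TV TW)).comp (adelicMpCont.twist F (Fin n) (adelicGram F eW TV TW) (pairSplitting F E c N (M₁ + M₂) eW JV JW s) η)) hρ' hrat' SK hSK)
      (seesawConjDatumTwist₁ F E c N M₁ M₂ eW e₁ e₂ JV JW J₁ J₂ hcδ hδ hd hV hW h₁ h₂ hVd hTWd h₁d h₂d hT hJV hJW hJ₁ hJ₂ hgg₀ hg hCC₀ hC hs hs₁ hs₂ hg₀ ηa hηa hM₃' SK₁ hSK₁) (seesawConjDatumTwist₂ F E c N M₁ M₂ eW e₁ e₂ JV JW J₁ J₂ hcδ hδ hd hV hW h₁ h₂ hVd hTWd h₁d h₂d hT hJV hJW hJ₁ hJ₂ hgg₀ hg hCC₀ hC hs hs₁ hs₂ hg₀ ηb hηb hM₄' SK₂ hSK₂)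
      ((adelicIsometryConj F E c (M₁ + M₂) g hg).comp (adelicBlockDiag F E c M₁ M₂ J₁ J₂))
      (seesawConjTensor F E c N M₁ M₂ eW JV JW J₁ J₂ hcδ hδ hd hV hW h₁ h₂ hVd hTWd hT hJV hJW hJ₁ hJ₂ hgg₀ hg hCC₀ hC Φ₁ Φ₂) Φ₁ Φ₂ :=
  fun x u₁ u₂ =>
    (congrArg (fun p : adelic F E c N JV × adelic F E c (M₁ + M₂) JW =>
        thetaDistLM F (Fin n) (((adelicMpCont.omega F (Fin n) (adelicGram F eW TV TW)).comp (adelicMpCont.twist F (Fin n) (adelicGram F eW TV TW) (pairSplitting F E c N (M₁ + M₂) eW JV JW s) η)) p (seesawConjTensor F E c N M₁ M₂ eW JV JW J₁ J₂ hcδ hδ hd hV hW h₁ h₂ hVd hTWd hT hJV hJW hJ₁ hJ₂ hgg₀ hg hCC₀ hC Φ₁ Φ₂)))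
        (prod_isometryConj_blockDiag_inv F E c N M₁ M₂ JV JW J₁ J₂ hg x u₁ u₂)).trans
      (thetaDistLM_twist_pairRep_isometryConj_seesawConjTensor_split F E c N M₁ M₂ eW e₁ e₂ JV JW J₁ J₂ hcδ hδ hd hV hW h₁ h₂ hVd hTWd h₁d h₂d hT hJV hJW hJ₁ hJ₂ hgg₀ hg hCC₀ hC hs hs₁ hs₂ η ηa ηb hsplit x⁻¹ u₁⁻¹ u₂⁻¹ Φ₁ Φ₂)

variable [CompactSpace (adelic F E c N JV ⧸ (toAdelic F E c N JV).range)]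
  [CompactSpace (adelic F E c M₁ J₁ ⧸ (toAdelic F E c M₁ J₁).range)]
  [MeasurableSpace (adelic F E c M₁ J₁ ⧸ (toAdelic F E c M₁ J₁).range)]
  [BorelSpace (adelic F E c M₁ J₁ ⧸ (toAdelic F E c M₁ J₁).range)]
  (μ₁ : Measure (adelic F E c M₁ J₁ ⧸ (toAdelic F E c M₁ J₁).range)) [IsFiniteMeasure μ₁]
  [CompactSpace (adelic F E c M₂ J₂ ⧸ (toAdelic F E c M₂ J₂).range)]
  [MeasurableSpace (adelic F E c M₂ J₂ ⧸ (toAdelic F E c M₂ J₂).range)]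
  [BorelSpace (adelic F E c M₂ J₂ ⧸ (toAdelic F E c M₂ J₂).range)]
  (μ₂ : Measure (adelic F E c M₂ J₂ ⧸ (toAdelic F E c M₂ J₂).range)) [IsFiniteMeasure μ₂]

include hsplit in
/-- **(eq:seesaw) for the NORMALISED big splitting, at the data of record**: the period of the theta kernel of
`ω_ψ ∘ (s_pair ⊗ η)` of `Φ₁ ⊗' Φ₂` over the conjugated see-saw torus against `f₁ ⊠ f₂` is the product of the `ω₁‴`- and
`ω₂‴`-theta lifts. [cite: Kudla1984, §1] -/
theorem seesawConjPeriodTwist_eq_thetaLift_mul (Φ₁ : piSchwartzBruhat F (Fin N × Fin M₁))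
    (Φ₂ : piSchwartzBruhat F (Fin N × Fin M₂))
    (f₁ : C(adelic F E c M₁ J₁ ⧸ (toAdelic F E c M₁ J₁).range, ℂ))
    (f₂ : C(adelic F E c M₂ J₂ ⧸ (toAdelic F E c M₂ J₂).range, ℂ))
    (ξ : adelic F E c N JV ⧸ (toAdelic F E c N JV).range) :
    ∫ q : (adelic F E c M₁ J₁ ⧸ (toAdelic F E c M₁ J₁).range) × (adelic F E c M₂ J₂ ⧸ (toAdelic F E c M₂ J₂).range),
        (ThetaKernelDatum.adelicOfDualPairRep (ΓU := (toAdelic F E c N JV).range)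
            (Γ := (toAdelic F E c (M₁ + M₂) JW).range) ((adelicMpCont.omega F (Fin n) (adelicGram F eW TV TW)).comp (adelicMpCont.twist F (Fin n) (adelicGram F eW TV TW) (pairSplitting F E c N (M₁ + M₂) eW JV JW s) η)) hρ' hrat' SK hSK).thetaKer
            (seesawConjTensor F E c N M₁ M₂ eW JV JW J₁ J₂ hcδ hδ hd hV hW h₁ h₂ hVd hTWd hT hJV hJW hJ₁ hJ₂ hgg₀ hg hCC₀ hC Φ₁ Φ₂)
            (ξ, seesawQuot ((adelicIsometryConj F E c (M₁ + M₂) g hg).comp (adelicBlockDiag F E c M₁ M₂ J₁ J₂))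
              (isometryConj_blockDiag_mem_range F E c M₁ M₂ JW J₁ J₂ hgg₀ hg hg₀) q) *
          (f₁ q.1 * f₂ q.2) ∂(μ₁.prod μ₂) =
      (seesawConjDatumTwist₁ F E c N M₁ M₂ eW e₁ e₂ JV JW J₁ J₂ hcδ hδ hd hV hW h₁ h₂ hVd hTWd h₁d h₂d hT hJV hJW hJ₁ hJ₂ hgg₀ hg hCC₀ hC hs hs₁ hs₂ hg₀ ηa hηa hM₃' SK₁ hSK₁).thetaLift μ₁ Φ₁ f₁ ξ *
        (seesawConjDatumTwist₂ F E c N M₁ M₂ eW e₁ e₂ JV JW J₁ J₂ hcδ hδ hd hV hW h₁ h₂ hVd hTWd h₁d h₂d hT hJV hJW hJ₁ hJ₂ hgg₀ hg hCC₀ hC hs hs₁ hs₂ hg₀ ηb hηb hM₄' SK₂ hSK₂).thetaLift μ₂ Φ₂ f₂ ξ :=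
  seesaw_period_eq_thetaLift_mul (isometryConj_blockDiag_mem_range F E c M₁ M₂ JW J₁ J₂ hgg₀ hg hg₀) μ₁ μ₂
    (isSeesawProduct_twist_seesawConjTensor F E c N M₁ M₂ eW e₁ e₂ JV JW J₁ J₂ hcδ hδ hd hV hW h₁ h₂ hVd hTWd h₁d h₂d hT hJV hJW hJ₁ hJ₂ hgg₀ hg hCC₀ hC hs hs₁ hs₂ hg₀ η ηa ηb hsplit hηa hηb hρ' hrat' SK hSK hM₃' SK₁ hSK₁ hM₄' SK₂
      hSK₂ Φ₁ Φ₂) f₁ f₂ ξ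

end TwistThirtyFour

end UnitaryDualPair

end Literature.NumberTheory.GelbartRogawski1991

end

/-! ### Build-lane note (ops-buildfix G11b-3 recipe v2, LEDGER B13-1/B14-5/B14-7, 2026-08-22)
`lean -o` (the hub build lane, never `lean`/the gate check) runs Lean 4.32's library-suggestion indexers
(`Lean.LibrarySuggestions.SymbolFrequency` / `SineQuaNon`, from their `exportEntriesFn`) over the statement of every local
theorem constant that is not a denied premise; on this family's statements (very large dependent binder telescopes) that fold
runs for tens of minutes (incident G11b-3, run/shared/lean/ops/buildfix/G11b-3-DOSSIER.md). `isDeniedPremise` skips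
`[implicit_reducible]` constants before any fold, and the status is inert on theorems (Meta never unfolds `thmInfo`).
v2 form: ONE file-final, top-level `local` attribute — it goes through the synchronous scoped reducibility extension that
`getReducibilityStatusCore` reads first, so it needs no `set_option Elab.async false` (parallel elaboration stays on), also
reaches auto-realized `*.congr_simp` / structure-projection theorem constants, is never popped before export, and is not
exported. No statement or proof is changed. -/
set_option allowUnsafeReducibility true in
attribute [local implicit_reducible]
  Literature.NumberTheory.GelbartRogawski1991.UnitaryDualPair.thetaDistLM_twist_pairRep_isometryConj_seesawConjTensor
  Literature.NumberTheory.GelbartRogawski1991.UnitaryDualPair.seesawConjRepTwist₁_apply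
  Literature.NumberTheory.GelbartRogawski1991.UnitaryDualPair.seesawConjRepTwist₂_apply
  Literature.NumberTheory.GelbartRogawski1991.UnitaryDualPair.thetaDistLM_twist_pairRep_isometryConj_seesawConjTensor_split
  Literature.NumberTheory.GelbartRogawski1991.UnitaryDualPair.seesawConjRepTwist₁_toHomUnits_mem_thetaStabilizer
  Literature.NumberTheory.GelbartRogawski1991.UnitaryDualPair.seesawConjRepTwist₂_toHomUnits_mem_thetaStabilizer
  Literature.NumberTheory.GelbartRogawski1991.UnitaryDualPair.hasThetaMajorants_seesawConjRepTwist₁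
  Literature.NumberTheory.GelbartRogawski1991.UnitaryDualPair.hasThetaMajorants_seesawConjRepTwist₂
  Literature.NumberTheory.GelbartRogawski1991.UnitaryDualPair.isSeesawProduct_twist_seesawConjTensor
  Literature.NumberTheory.GelbartRogawski1991.UnitaryDualPair.seesawConjPeriodTwist_eq_thetaLift_mul
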